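import Summits.BirchSwinnertonDyer.BirchSwinnertonDyer.Theorems.AlignedTransportAtTwoMainConjectureOfRankZeroBSDAtTwoOrdinaryStandardShapeExact
import Summits.BirchSwinnertonDyer.Rank1Residual.X5.TwoAdicImageCertificates
import HarnessLib

/-!
# Route `AlignedTransportAtTwo`, crux C2 `MainConjectureOfRankZeroBSDAtTwo` (stmt-BirchSwinnertonDyer-22298):
# A WITNESS FOR THE SHAPE BINDER — the triple `(a₂, a₄, a₆) = (0, 0, 1)`: `x³ + x² + 64` has no rational root (none modulo `7`), `Δ[1,0,0,0,1] = −433`,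
# and the cubic field `ℚ(x(P))` of `y² + xy = x³ + 1` contains a root; so the integer-triple named input is NOT vacuous

HONEST FRAMING. WIDTH-5 attached prover seat `bsd-line-att-p4` g35 on line `birth`; `--supports` stmt-BirchSwinnertonDyer-22298, closes nothing; BSD is NOT
proved; crux C2, its verdict and every registered stub untouched. THEOREMS ONLY (no `def`, no named fact, no `sorry`); UNCONDITIONAL. Companion of
`…OrdinaryStandardShape{,Exact,Crux}` (this seat, same gen): the A3 (non-vacuity) instance for the binder SHAPE — a triple meeting all three hypotheses
(`a₄ + a₆` odd, no rational root, `Δ ∉ ℤ²`) together with a cubic number field containing a root — so that «SHAPE» is a genuine `∀` over a non-empty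
index set, and by the exact image a GLOBALLY MINIMAL good-ordinary curve with `E(ℚ)[2] = 0`, `Δ ∉ ℚ²` realising it exists.

* `shape_001_ne_zero` (no rational root of `x³ + x² + 64`: no root modulo `7`), `Δ_001` (`Δ[1,0,0,0,1] = −433`), `not_isSquare_Δ_001`,
  ★ `exists_standardShape_witness` (a triple meeting the three hypotheses), ★ `exists_cubicField_standardShape_root` (a cubic NUMBER FIELD — the model
  `ℚ⟮β₀⟯` of the cubic `2`-torsion field of `[1,0,0,0,1] ⊗ ℚ` — containing a root of `x³ + x² + 64`; it is not Galois, embeds into `ℚ₂`, has `v₂(d_F)`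
  even), `exists_cellCurve_witness` (a globally minimal good-ordinary curve with `E(ℚ)[2] = 0`, `Δ ∉ ℚ²` whose `u`-cubic has the roots of `x³ + x² + 64`
  up to a rational affinity).
PARTITION: none; beyond-print theorem: no; BSD is NOT proved by any of this.

References: [SilvermanAEC2009] III.§1, VIII.§8; tree: `…OrdinaryStandardShape{,Exact}` (g35), `X5.TwoAdicImageCertificates` (`forall_cubic_ne_zero_of_forall_ne`),
`…PointFieldCarrierCM` (`finrank_adjoin_xT_model`), `…SharedCubicDivisionField` (`aeval_four_mul_xT_twoDivisionUCubic`), `…CMSexticFieldDoor` (`aeval_mk_eq_zero_of_aeval_eq_zero`).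
-/

-- the Theorems namespace of this sub repeats the summit name by design (D-0017 nested layout)
set_option linter.dupNamespace false
set_option autoImplicit false

noncomputable section

open scoped NumberField IntermediateField

namespace Summit.BirchSwinnertonDyer.BirchSwinnertonDyer.Theorems.AlignedTransportAtTwoOrdinaryStandardShapeWitness

open NumberField Polynomial WeierstrassCurve IntermediateField Field
  Literature.NumberTheory.EllipticCurves Literature.NumberTheory.EllipticCurves.Greenberg1999
  Literature.NumberTheory.EllipticCurves.DokchitserDokchitser2012
  Summit.BirchSwinnertonDyer.Rank1Residual.F1Sign2
  Summit.BirchSwinnertonDyer.BirchSwinnertonDyer.Theorems.AlignedTransportAtTwoOrdinaryStandardShape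
  Summit.BirchSwinnertonDyer.BirchSwinnertonDyer.Theorems.AlignedTransportAtTwoOrdinaryStandardShapeExact
  Summit.BirchSwinnertonDyer.BirchSwinnertonDyer.Theorems.AlignedTransportAtTwoPointFieldCarrierCM
  Summit.BirchSwinnertonDyer.BirchSwinnertonDyer.Theorems.AlignedTransportAtTwoSharedCubicDivisionField
  Summit.BirchSwinnertonDyer.BirchSwinnertonDyer.Theorems.AlignedTransportAtTwoCMSexticFieldDoor

/-! ## The witness `(a₂, a₄, a₆) = (0, 0, 1)`: `x³ + x² + 64`, `Δ = −433` -/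

section Witness

/-- **`x³ + x² + 64` — the shape cubic of `(a₂, a₄, a₆) = (0, 0, 1)` — has no rational root** (no root modulo `7`). [cite: SilvermanAEC2009, III.2.3 (b)] -/
theorem shape_001_ne_zero : ∀ x : ℚ, x ^ 3 + (1 + 4 * ((0 : ℤ) : ℚ)) * x ^ 2 + 16 * ((0 : ℤ) : ℚ) * x + 64 * ((1 : ℤ) : ℚ) ≠ 0 := by
  intro x hx
  refine Summit.BirchSwinnertonDyer.Rank1Residual.X5.O1.forall_cubic_ne_zero_of_forall_ne (c₂ := 1) (c₁ := 0) (c₀ := 64) (ℓ := 7)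
    (by decide) x ?_
  push_cast at hx ⊢
  linear_combination hx

/-- `Δ[1, 0, 0, 0, 1] = −433` (the curve `y² + xy = x³ + 1`). [cite: SilvermanAEC2009, III.§1] -/
theorem Δ_001 : (⟨1, 0, 0, 0, 1⟩ : WeierstrassCurve ℤ).Δ = -433 := by
  rw [Δ_standard_eq]; norm_num

/-- `Δ[1, 0, 0, 0, 1] = −433` is not a square. [folklore] -/
theorem not_isSquare_Δ_001 : ¬ IsSquare (⟨1, 0, 0, 0, 1⟩ : WeierstrassCurve ℤ).Δ := by
  rw [Δ_001]
  rintro ⟨r, hr⟩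
  nlinarith [mul_self_nonneg r]

/-- ★ **THE SHAPE BINDER IS NOT VACUOUS (triple level)**: `(a₂, a₄, a₆) = (0, 0, 1)` has `a₄ + a₆` odd, shape cubic `x³ + x² + 64` without rational root,
and `Δ[1,0,0,0,1] = −433 ∉ ℤ²`. [cite: SilvermanAEC2009, III.§1 and III.2.3 (b)] -/
theorem exists_standardShape_witness :
    ∃ a₂ a₄ a₆ : ℤ, Odd (a₄ + a₆) ∧
      (∀ x : ℚ, x ^ 3 + (1 + 4 * (a₂ : ℚ)) * x ^ 2 + 16 * (a₄ : ℚ) * x + 64 * (a₆ : ℚ) ≠ 0) ∧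
      ¬ IsSquare (⟨1, a₂, 0, a₄, a₆⟩ : WeierstrassCurve ℤ).Δ :=
  ⟨0, 0, 1, by decide, shape_001_ne_zero, not_isSquare_Δ_001⟩

/-- ★ **THE SHAPE BINDER IS NOT VACUOUS (field level)**: there is a cubic NUMBER FIELD containing a root of `x³ + x² + 64` — the model `ℚ⟮β₀⟯` of the
cubic `2`-torsion field of the standard model `[1, 0, 0, 0, 1] ⊗ ℚ` (`y² + xy = x³ + 1`, `E(ℚ)[2] = 0`), with the root `4β₀`. By `…OrdinaryStandardShapeExact`
§2 it is not Galois over `ℚ`, embeds into `ℚ₂` and has `v₂(d_F)` even. [cite: SilvermanAEC2009, III.§1 and VIII.§1] -/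
theorem exists_cubicField_standardShape_root :
    ∃ (F : Type) (_ : Field F) (_ : NumberField F), Module.finrank ℚ F = 3 ∧
      ∃ e : F, e ^ 3 + (1 + 4 * ((0 : ℤ) : F)) * e ^ 2 + 16 * ((0 : ℤ) : F) * e + 64 * ((1 : ℤ) : F) = 0 := by
  haveI hE := isElliptic_standard 0 0 1 (by decide)
  have ht : ∀ x : ℚ, ¬ HasRationalTwoTorsionX ((⟨1, 0, 0, 0, 1⟩ : WeierstrassCurve ℤ).baseChange ℚ) x :=
    not_hasRationalTwoTorsionX_standard 0 0 1 shape_001_ne_zero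
  set B : IntermediateField ℚ (AlgebraicClosure ℚ) :=
    ℚ⟮xT ((⟨1, 0, 0, 0, 1⟩ : WeierstrassCurve ℤ).baseChange ℚ) two_ne_zero 0⟯ with hB
  haveI : FiniteDimensional ℚ ↥B := adjoin.finiteDimensional ((AlgebraicClosure.isAlgebraic ℚ).isAlgebraic _).isIntegral
  haveI : NumberField ↥B := NumberField.mk
  have h3 : Module.finrank ℚ ↥B = 3 := finrank_adjoin_xT_model _ ht 0
  have h4mem : (4 : AlgebraicClosure ℚ) * xT ((⟨1, 0, 0, 0, 1⟩ : WeierstrassCurve ℤ).baseChange ℚ) two_ne_zero 0 ∈ B :=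
    mul_mem (ofNat_mem B 4) (mem_adjoin_simple_self ℚ _)
  have he : aeval (⟨4 * xT ((⟨1, 0, 0, 0, 1⟩ : WeierstrassCurve ℤ).baseChange ℚ) two_ne_zero 0, h4mem⟩ : ↥B)
      (twoDivisionUCubic ((⟨1, 0, 0, 0, 1⟩ : WeierstrassCurve ℤ).baseChange ℚ)) = 0 :=
    aeval_mk_eq_zero_of_aeval_eq_zero _ B (aeval_four_mul_xT_twoDivisionUCubic _ 0) h4mem
  rw [aeval_twoDivisionUCubic_standard] at he
  exact ⟨↥B, inferInstance, inferInstance, h3, _, he⟩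

/-- ★ **A globally minimal good-ORDINARY curve with `E(ℚ)[2] = 0`, `Δ ∉ ℚ²` realising the witness**: the exact image of `(0, 0, 1)` — a global minimal
model of `y² + xy = x³ + 1` whose `u`-cubic has, up to a rational affinity, the roots of `x³ + x² + 64`. UNCONDITIONAL.
[cite: SilvermanAEC2009, VIII.§8 Cor. 8.3] [cite: Neron1964] -/
theorem exists_cellCurve_witness :
    ∃ (W : WeierstrassCurve ℚ) (_ : W.IsElliptic) (_ : W.IsGloballyMinimal),
      IsOrdinaryAt W 2 ∧ (∀ x : ℚ, ¬ HasRationalTwoTorsionX W x) ∧ ¬ IsSquare W.Δ ∧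
      ∃ q s : ℚ, q ≠ 0 ∧ ∀ {K : Type} [Field K] [CharZero K] [Algebra ℚ K] (e : K),
        aeval e (twoDivisionUCubic W) = 0 ↔
          ((q : K) * e + (s : K)) ^ 3 + (1 + 4 * ((0 : ℤ) : K)) * ((q : K) * e + (s : K)) ^ 2 +
              16 * ((0 : ℤ) : K) * ((q : K) * e + (s : K)) + 64 * ((1 : ℤ) : K) = 0 :=
  exists_cellCurve_of_standardShape 0 0 1 (by decide) shape_001_ne_zero not_isSquare_Δ_001

end Witness

end Summit.BirchSwinnertonDyer.BirchSwinnertonDyer.Theorems.AlignedTransportAtTwoOrdinaryStandardShapeWitness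

end
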